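import Mathlib
import Literature.RingTheory.CohomologyAnnihilator.RegularLocalRing
import Literature.AlgebraicGeometry.Resolution.CompositeValuations
import HarnessLib

/-!
# Crux `StrictDrop` (stmt-ResolutionOfSingularities-16485), line `birth` — stub `stub_regular_drop`

Route `ResolutionOfSingularities/HomologicalConductor`, endpoint calibration (SC) of the line
`birth`: along the canonical normalised `ca`-tower `T₀ = loc A`, `T_(m+1) = loc (nrm (chart T_m))`
of a finitely generated `A ⊆ O ⊆ K` (`O` a valuation ring of `K ⊇ k`), if the stage `T_m` is NOT a
regular local ring and the stage `T_n` IS one, then `T_n` carries a non-zero cohomology annihilator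
`y` with `y * x⁻¹ ∉ O` (i.e. `v(y) < v(x)`) for every non-zero `x ∈ ca(T_m)`; here every stage is
assumed to have the tower `Shape` (noetherian, `⊆ O`, local at the centre of `O`: an element of the
stage invertible in `O` is invertible in the stage), which is the neighbouring stub
`stub_towerShape` and enters as a hypothesis.

Proof (witness `y = 1`):

* `1 ∈ ca(T_n)`: the cohomology annihilator of a regular local ring is the unit ideal
  (`Literature.RingTheory.CohomologyAnnihilator.cohomologyAnnihilator_eq_top_of_isRegularLocalRing`,
  [IyengarTakahashi2014, Example 2.5] + Auslander–Buchsbaum–Serre), and the route's inlined `ca T`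
  is literally `(↑) '' ca(↥T)` (`Subalgebra.image_coe_cohomologyAnnihilator`).
* for `x ∈ ca(T_m)`, `x ≠ 0`: `T_m` is a noetherian LOCAL ring (it sits inside the local ring `O`
  and is closed under the inverses of its `O`-units, which lie in `O`:
  `Literature.AlgebraicGeometry.Resolution.inv_mem_of_isUnit`), it is singular, so `ca(T_m) ⊆ 𝔪`
  (`cohomologyAnnihilator_le_maximalIdeal_of_not_isRegularLocalRing`,
  [IyengarTakahashi2014, Lemma 2.10 (2)]); hence `x` is not a unit of `T_m`, so `x⁻¹ ∉ T_m`, so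
  `x⁻¹ ∉ O` by locality at the centre, i.e. `1 * x⁻¹ ∉ O`.

The statement is the registered stub with the route's `let`-bound tower inlined verbatim
(definitionally equal, `Iff.rfl`, to `Sig.stub_regular_drop` of the line skeleton
`Cruxes/StrictDrop/Lines/birth.lean`).
-/

noncomputable section

-- single-problem summit: the doubled namespace component is forced
set_option linter.dupNamespace false

namespace Summit.ResolutionOfSingularities.ResolutionOfSingularities.Theorems.StrictDrop.Birth.RegularDrop

open Literature.RingTheory.CohomologyAnnihilator Literature.AlgebraicGeometry.Resolution IsLocalRing

/-! ## One stage: a subalgebra `T ⊆ O` local at the centre of `O` -/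

section Stage

variable {k K : Type} [Field k] [Field K] [Algebra k K]

/-- A stage `T ⊆ O` local at the centre of `O`: an element of `T` which is a unit of `O` is a
unit of `T`. [folklore] -/
theorem isUnit_of_isUnit_valuationSubring (O : ValuationSubring K) (T : Subalgebra k K)
    (hTO : T.toSubring ≤ O.toSubring) (hunit : ∀ s ∈ T, s⁻¹ ∈ O → s⁻¹ ∈ T) (t : T)
    (hu : IsUnit (⟨(t : K), hTO t.2⟩ : O)) : IsUnit t := by
  -- `t⁻¹ ∈ O` (`Literature.AlgebraicGeometry.Resolution.inv_mem_of_isUnit`), so `t⁻¹ ∈ T`.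
  have ht0 : (t : K) ≠ 0 := fun h0 => hu.ne_zero (Subtype.ext h0)
  have hinvT : (t : K)⁻¹ ∈ T := hunit t t.2 (inv_mem_of_isUnit O (hTO t.2) hu)
  exact IsUnit.of_mul_eq_one ⟨(t : K)⁻¹, hinvT⟩ (Subtype.ext (mul_inv_cancel₀ ht0))

/-- A stage `T ⊆ O` local at the centre of `O` is a local ring (with `𝔪_T = T ∩ 𝔪_O`): for
`a ∈ T`, either `a` or `1 - a` is a unit of the local ring `O`, hence of `T`. [folklore] -/
theorem isLocalRing_of_le_valuationSubring (O : ValuationSubring K) (T : Subalgebra k K)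
    (hTO : T.toSubring ≤ O.toSubring) (hunit : ∀ s ∈ T, s⁻¹ ∈ O → s⁻¹ ∈ T) :
    IsLocalRing T := by
  refine IsLocalRing.of_isUnit_or_isUnit_one_sub_self fun a => ?_
  rcases IsLocalRing.isUnit_or_isUnit_one_sub_self (⟨(a : K), hTO a.2⟩ : O) with hu | hu
  · exact Or.inl (isUnit_of_isUnit_valuationSubring O T hTO hunit a hu)
  · refine Or.inr (isUnit_of_isUnit_valuationSubring O T hTO hunit (1 - a) ?_)
    have h : (⟨((1 - a : T) : K), hTO (1 - a).2⟩ : O) = 1 - ⟨(a : K), hTO a.2⟩ :=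
      Subtype.ext (by simp)
    rwa [h]

/-- **`1 ∈ ca` of a regular stage**: for a subalgebra `T` of `K` which is a regular local ring,
`1` lies in (the image in `K` of) the cohomology annihilator `ca(T)`, since `ca` of a regular
local ring is the unit ideal. [cite: IyengarTakahashi2014, Example 2.5] -/
theorem one_mem_image_cohomologyAnnihilator (T : Subalgebra k K) (hreg : IsRegularLocalRing T) :
    (1 : K) ∈ ((↑) : T → K) '' (cohomologyAnnihilator T : Set T) := by
  haveI := hreg
  refine ⟨1, ?_, OneMemClass.coe_one T⟩
  rw [SetLike.mem_coe, cohomologyAnnihilator_eq_top_of_isRegularLocalRing (R := T)]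
  exact Submodule.mem_top

/-- **Non-zero annihilators of a singular stage have positive value**: for a noetherian stage
`T ⊆ O` local at the centre of `O` which is NOT a regular local ring, a non-zero `z ∈ ca(T)` lies
in `𝔪_T` (`ca(T) ⊆ 𝔪_T` for singular `T`), so it is not a unit of `T`, so `z⁻¹ ∉ T`, so
`z⁻¹ ∉ O`. [cite: IyengarTakahashi2014, Lemma 2.10 (2)] -/
theorem inv_not_mem_of_mem_cohomologyAnnihilator (O : ValuationSubring K) (T : Subalgebra k K)
    (hNoeth : IsNoetherianRing T) (hTO : T.toSubring ≤ O.toSubring)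
    (hunit : ∀ s ∈ T, s⁻¹ ∈ O → s⁻¹ ∈ T) (hsing : ¬ IsRegularLocalRing T) (z : T)
    (hz : z ∈ cohomologyAnnihilator T) (hz0 : (z : K) ≠ 0) : (z : K)⁻¹ ∉ O := by
  haveI : IsLocalRing T := isLocalRing_of_le_valuationSubring O T hTO hunit
  haveI := hNoeth
  intro hinv
  have hmax : z ∈ maximalIdeal T :=
    cohomologyAnnihilator_le_maximalIdeal_of_not_isRegularLocalRing (R := T) hsing hz
  have hzu : IsUnit z :=
    IsUnit.of_mul_eq_one ⟨(z : K)⁻¹, hunit z z.2 hinv⟩ (Subtype.ext (mul_inv_cancel₀ hz0))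
  exact (IsLocalRing.mem_maximalIdeal z).mp hmax hzu

end Stage

/-! ## The stub, in the registered (inlined, `let`-bound) form -/

/-- **Stub `stub_regular_drop` (SC, endpoint calibration) of line `birth` of the crux
`StrictDrop`.** Along the canonical normalised `ca`-tower of `A ⊆ O ⊆ K` whose stages all have the
tower shape, if the stage `m` is not a regular local ring and the stage `n` is, then
`y = 1 ∈ ca(T_n)` is non-zero and `1 * x⁻¹ ∉ O` for every non-zero `x ∈ ca(T_m)`
(`ca(T_n) = T_n` for `T_n` regular; `ca(T_m) ⊆ 𝔪_(T_m) = T_m ∩ 𝔪_O` for `T_m` singular).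
[cite: IyengarTakahashi2014, Example 2.5 and Lemma 2.10 (2)] -/
theorem stub_regular_drop : ∀ p : ℕ, p.Prime → ∀ (k K : Type) [Field k] [CharP k p] [Field K] [Algebra k K] (O : ValuationSubring K) (A : Subalgebra k K), (∀ c : k, algebraMap k K c ∈ O) → A.FG → IsFractionRing ↥A K → A.toSubring ≤ O.toSubring → let ca : Subalgebra k K → Set K := fun A => {x : K | ∃ hx : x ∈ A, ∃ n : ℕ, ∀ i : ℕ, n ≤ i → ∀ (M N : ModuleCat.{0} ↥A), Module.Finite ↥A M → Module.Finite ↥A N → ∀ e : CategoryTheory.Abelian.Ext.{0} M N i, (⟨x, hx⟩ : ↥A) • e = 0}; let loc : Subalgebra k K → Subalgebra k K := fun A => Algebra.adjoin k {y : K | ∃ a ∈ A, ∃ s ∈ A, s⁻¹ ∈ O ∧ y = a * s⁻¹}; let chart : Subalgebra k K → Subalgebra k K := fun A => Algebra.adjoin k ((A : Set K) ∪ {y : K | ∃ c ∈ ca A, ∃ x ∈ ca A, x ≠ 0 ∧ (∀ c' ∈ ca A, c' * x⁻¹ ∈ O) ∧ y = c * x⁻¹}); let nrm : Subalgebra k K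 → Subalgebra k K := fun B => Algebra.adjoin k {y : K | IsIntegral ↥B y}; let tower : Subalgebra k K → ℕ → Subalgebra k K := fun A m => @Nat.rec (fun _ => Subalgebra k K) (loc A) (fun _ B => loc (nrm (chart B))) m; let Shape : Subalgebra k K → Prop := fun T => (∃ B : Subalgebra k K, B.FG ∧ B ≤ T ∧ loc B = T ∧ ∀ t ∈ T, ∃ b ∈ B, ∃ s ∈ B, s⁻¹ ∈ O ∧ t = b * s⁻¹) ∧ IsNoetherianRing ↥T ∧ T.toSubring ≤ O.toSubring ∧ ∀ s ∈ T, s⁻¹ ∈ O → s⁻¹ ∈ T; (∀ m : ℕ, Shape (tower A m)) → ∀ m n : ℕ, ¬ IsRegularLocalRing ↥(tower A m) → IsRegularLocalRing ↥(tower A n) → ∃ y ∈ ca (tower A n), y ≠ 0 ∧ ∀ x ∈ ca (tower A m), x ≠ 0 → y * x⁻¹ ∉ O := by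
  intro p _ k K _ _ _ _ O A _ _ _ _ ca loc chart nrm tower Shape hShape m n hm hn
  obtain ⟨-, hNoeth, hTO, hunit⟩ := hShape m
  refine ⟨1, ?_, one_ne_zero, fun x hx hx0 => ?_⟩
  · -- `1 ∈ ca (tower A n)`: the inlined `ca` is literally `(↑) '' ca(↥(tower A n))`.
    have h := one_mem_image_cohomologyAnnihilator (tower A n) hn
    rw [Subalgebra.image_coe_cohomologyAnnihilator] at h
    exact h
  · -- `x ∈ ca (tower A m)`, `x ≠ 0`: `x⁻¹ ∉ O`.
    have hx' : x ∈ ((↑) : ↥(tower A m) → K) '' (cohomologyAnnihilator ↥(tower A m) : Set _) := by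
      rw [Subalgebra.image_coe_cohomologyAnnihilator]
      exact hx
    obtain ⟨z, hz, rfl⟩ := hx'
    rw [one_mul]
    exact inv_not_mem_of_mem_cohomologyAnnihilator O (tower A m) hNoeth hTO hunit hm z hz hx0

end Summit.ResolutionOfSingularities.ResolutionOfSingularities.Theorems.StrictDrop.Birth.RegularDrop

end
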